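import Mathlib.Algebra.Module.LinearMap.Defs
import Mathlib.Algebra.BigOperators.Group.Finset.Basic
import Mathlib.Topology.Algebra.InfiniteSum.Basic
import Mathlib.Topology.Algebra.InfiniteSum.Order
import Mathlib.Topology.Algebra.InfiniteSum.Real
import Mathlib.Tactic.Linarith
import Mathlib.Tactic.Ring
import Literature.MathematicalPhysics.QuantumFieldTheory.ConformalBootstrap3D.SigmaEpsilonSystem
import HarnessLib

/-!
# Dual (linear-functional) exclusion for the σ–ε bootstrap system — the abstract argument, proved

The standard argument by which the numerical conformal bootstrap excludes CFT data
(Rattazzi–Rychkov–Tonni–Vichi, JHEP 12 (2008) 031, §5: "there is NO functional Λ such that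
Λ(F_{d,Δ,l}) ≥ 0 for all Δ, l ∈ Σ(Δ_min)" ⟺ the assumed spectrum is consistent; for the `σ–ε`
mixed system:
Kos–Poland–Simmons-Duffin, JHEP 11 (2014) 109, §3.2 eq. (3.13)–(3.15) and §3.3 eq. (3.16)),
stated over the typed axioms of `SigmaEpsilonSystem.lean` (`SigmaEpsilonData.SatisfiesBootstrapAxioms`,
A1–A4) and PROVED as a theorem of elementary real analysis (sums of convergent series):

* `CrossingFunctional` — a 5-vector `α = (α¹,…,α⁵)` of real-linear functionals on functions of
  `(z, z̄)`, one per sum rule (Kos–Poland–Simmons-Duffin 2014, §3.2: "Let `α⃗ = (α¹,…,α⁵)` be a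
  5-vector of functionals").
* `CrossingFunctional.IsPositiveAt α Δσ Δε` — the three conditions of Kos–Poland–Simmons-Duffin
  2014, eq. (3.16), written out with the matrix `α⃗·V⃗₊` of their eq. (3.14): the identity term
  `(1 1) α⃗·V⃗_{+,0,0} (1 1)ᵀ > 0` (`identityTerm`), the `2×2` quadratic form `α⃗·V⃗_{+,Δ,ℓ} ⪰ 0`
  for every `ℤ₂`-even exchanged `(Δ, ℓ)` allowed by A1/A4 (`evenForm`, stated as non-negativity of
  the quadratic form, which is all that is used) and `α⃗·V⃗_{-,Δ,ℓ} ≥ 0` for every `ℤ₂`-odd one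
  (`oddForm`; the spin-parity sign `(-1)^ℓ` sits on the `α³` (`⟨σεσε⟩`, block family `a = -b`)
  entry for the `c_ℓ = 1` blocks of A2 — ERRATUM 2026-08-19, see `SigmaEpsilonData.SatisfiesCrossing`:
  until then the tree carried Kos–Poland–Simmons-Duffin's placement on `α⁴, α⁵`, which is correct
  only for their `(-1)^ℓ`-normalised blocks). "Allowed by A1/A4" is copied literally from `SatisfiesUnitarity` and
  `OnlySigmaEpsilonRelevant`: even spin and the unitarity bound in the even sector, the bound in
  the odd sector, and scalars below `Δ = 3` only at `Δ_ε` (even) / `Δ_σ` (odd). The conditions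
  quantify over EVERY function `g` satisfying the genuine-block predicate `IsConformalBlock3D`
  with the right parameters — so no uniqueness or evaluation theorem for blocks is used HERE; that
  burden (REFEREE.md T1) falls on whoever verifies `IsPositiveAt` for a concrete `α`.
* `CrossingFunctional.AppliesTermwise α D` — the functional commutes with the five sums of
  `D.SatisfiesCrossing` (REFEREE.md T4, the only analytic input of the argument), and
  `not_isPositiveAt_of_appliesTermwise` — THE ARGUMENT: A1 ∧ A2 ∧ A4 ∧ termwise action ∧ positivity
  at `(Δ_σ, Δ_ε)` is contradictory (apply `αⁱ` to rule `i`, add: the even-sector series has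
  non-negative terms `(λ_σσ𝒪, λ_εε𝒪) α⃗·V⃗₊ (λ_σσ𝒪, λ_εε𝒪)ᵀ`, the odd-sector series has
  non-negative terms `λ_σε𝒪² α⃗·V⃗₋`, and their sums add up to minus the identity term).
* `EvaluationContinuous φ` — a class of functionals for which T4 is a theorem with no further
  hypothesis: `φ` maps every family of functions that is pointwise summable on the open square
  `(0,1)²` to a summable family with the right sum. Finite linear combinations of point
  evaluations at points of the square (`pointFunctional`) are evaluation-continuous
  (`evaluationContinuous_pointFunctional`), and `appliesTermwise_of_isEvaluationContinuous` proves
  T4 for them from A3 alone. Derivative functionals at `z = z̄ = 1/2` (the basis of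
  Kos–Poland–Simmons-Duffin 2014, eq. (3.17)) are NOT evaluation-continuous; for them
  `AppliesTermwise` needs the convergence clause A1 (`HasConvergentWeights`) and uniform bounds on
  blocks, which is not done here (REFEREE.md T4, F12: the certificate architecture (C) uses point
  functionals, whose finite differences span the derivative functionals in the limit).
* `boxExcluded_of_functional` — for every evaluation-continuous `α` positive at every point of a
  set `Q`: `BoxExcluded Q` (box-uniform exclusion, REFEREE.md F3); `boxExcluded_of_pointFunctional`
  is the point-evaluation instance a certificate instantiates; `BoxExcluded.mono`.
* `quadForm_nonneg_of_det` — the `2×2` PSD criterion `X, Y ≥ 0`, `Z² ≤ 4XY` that a rational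
  certificate checks entrywise, implies the quadratic-form condition of `IsPositiveAt`.
* `exists_step_of_mem_Icc`, `Icc_prod_subset_iUnion_cells`, `isingEnclosure_of_grid` — the
  finite-certificate assembly on a product grid of the window `W = [x₀,x_N] × [y₀,y_M]`: if every
  cell is either contained in `R` or excluded, then `IsingEnclosure W R` (REFEREE.md T5; the
  general cover lemma is `isingEnclosure_of_cover` of `SigmaEpsilonSystem.lean`).

What this file does NOT contain: any concrete functional, any certificate, any value of
`(Δ_σ, Δ_ε)`; uniqueness/evaluation of blocks (T1); termwise action for derivative functionals;
anything about the Ising model on `ℤ³` (see `LatticeGapNonClaim.lean`).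

Sources: R. Rattazzi, V. S. Rychkov, E. Tonni, A. Vichi, JHEP 12 (2008) 031, §5 (linear
functionals on the sum rule, bib key `RattazziEtAl2008`); F. Kos, D. Poland, D. Simmons-Duffin, JHEP 11 (2014) 109, §3.2–3.3
eqs. (3.13)–(3.17); D. Poland, S. Rychkov, A. Vichi, Rev. Mod. Phys. 91 (2019) 015002, §IV.A
(linear-programming formulation). Mathlib: `LinearMap`, `HasSum`, `HasSum.add/sub/nonneg/unique`,
`hasSum_sum`, `Nat.findGreatest`; nothing on conformal field theory exists in Mathlib.
-/

namespace Literature.MathematicalPhysics.QuantumFieldTheory.ConformalBootstrap3D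

open Set

/-! ### Functionals -/

/-- A 5-vector `α⃗ = (α¹, …, α⁵)` of real-linear functionals on functions of `(z, z̄)`, `αⁱ`
acting on the `i`-th sum rule of `SigmaEpsilonData.SatisfiesCrossing`
(Kos–Poland–Simmons-Duffin 2014, §3.2, text before eq. (3.14)). Linearity is over the pointwise
vector-space structure of `ℝ → ℝ → ℝ`. [cite: KosPolandSimmonsduffin2014, §3.2 eq. (3.14)] -/
structure CrossingFunctional where
  /-- `α¹`, applied to sum rule 1 (`⟨σσσσ⟩`). -/
  α₁ : (ℝ → ℝ → ℝ) →ₗ[ℝ] ℝ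
  /-- `α²`, applied to sum rule 2 (`⟨εεεε⟩`). -/
  α₂ : (ℝ → ℝ → ℝ) →ₗ[ℝ] ℝ
  /-- `α³`, applied to sum rule 3 (`⟨σεσε⟩`, odd sector only). -/
  α₃ : (ℝ → ℝ → ℝ) →ₗ[ℝ] ℝ
  /-- `α⁴`, applied to sum rule 4 (`F₋` part of `⟨σσεε⟩`). -/
  α₄ : (ℝ → ℝ → ℝ) →ₗ[ℝ] ℝ
  /-- `α⁵`, applied to sum rule 5 (`F₊` part of `⟨σσεε⟩`). -/
  α₅ : (ℝ → ℝ → ℝ) →ₗ[ℝ] ℝ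

namespace CrossingFunctional

/-- The identity contribution `(1 1) α⃗·V⃗_{+,0,0} (1 1)ᵀ = α¹[F^{σσ,σσ}_{-,𝟙}] + α²[F^{εε,εε}_{-,𝟙}]
+ α⁴[F^{σσ,εε}_{-,𝟙}] + α⁵[F^{σσ,εε}_{+,𝟙}]` (block `1`, `λ_{σσ𝟙} = λ_{εε𝟙} = 1`; prefactor
exponents `Δ_σ`, `Δ_ε`, `s = (Δ_σ+Δ_ε)/2`, `s` as in `SatisfiesCrossing`).
(Kos–Poland–Simmons-Duffin 2014, §3.2 eq. (3.15), §3.3 eq. (3.16) first line.)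
[cite: KosPolandSimmonsduffin2014, §3.2 eq. (3.15)] -/
noncomputable def identityTerm (α : CrossingFunctional) (Δσ Δε : ℝ) : ℝ :=
  α.α₁ (crossF Δσ (-1) (fun _ _ => (1 : ℝ))) + α.α₂ (crossF Δε (-1) (fun _ _ => (1 : ℝ)))
    + α.α₄ (crossF ((Δσ + Δε) / 2) (-1) (fun _ _ => (1 : ℝ)))
    + α.α₅ (crossF ((Δσ + Δε) / 2) 1 (fun _ _ => (1 : ℝ)))

/-- The quadratic form of the `ℤ₂`-even sector: for an exchanged `𝒪⁺` with block `g = g^{0,0}_{Δ,ℓ}`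
and `(a, b) = (λ_{σσ𝒪}, λ_{εε𝒪})`,
`(a b) α⃗·V⃗_{+,Δ,ℓ} (a b)ᵀ = a² α¹[F^{σσ,σσ}_-] + b² α²[F^{εε,εε}_-] + a b (α⁴[F^{σσ,εε}_-] + α⁵[F^{σσ,εε}_+])`
(the off-diagonal entry of `α⃗·V⃗₊` is `½ α⁴[F_-] + ½ α⁵[F_+]`).
(Kos–Poland–Simmons-Duffin 2014, §3.2 eq. (3.14).) [cite: KosPolandSimmonsduffin2014, §3.2 eq. (3.14)] -/
noncomputable def evenForm (α : CrossingFunctional) (Δσ Δε : ℝ) (g : ℝ → ℝ → ℝ) (a b : ℝ) : ℝ :=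
  a ^ 2 * α.α₁ (crossF Δσ (-1) g) + b ^ 2 * α.α₂ (crossF Δε (-1) g)
    + a * b * (α.α₄ (crossF ((Δσ + Δε) / 2) (-1) g) + α.α₅ (crossF ((Δσ + Δε) / 2) 1 g))

/-- The `ℤ₂`-odd sector: for an exchanged `𝒪⁻` of spin `ℓ` with blocks `g₁ = g^{Δ_σε,Δ_σε}_{Δ,ℓ}`
(entering `⟨σεσε⟩`) and `g₂ = g^{-Δ_σε,Δ_σε}_{Δ,ℓ}` (entering `⟨εσσε⟩`), both normalised by `c_ℓ = 1`
(A2, `HasLeadingPart`),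
`α⃗·V⃗_{-,Δ,ℓ} = (-1)^ℓ α³[F^{σε,σε}_-[g₁]] + α⁴[F^{εσ,σε}_-[g₂]] - α⁵[F^{εσ,σε}_+[g₂]]`.
This is Kos–Poland–Simmons-Duffin 2014, eq. (3.13)–(3.14), `V⃗_- = (0, 0, F^{σε,σε}_-, (-1)^ℓ F^{εσ,σε}_-,
-(-1)^ℓ F^{εσ,σε}_+)` for their blocks `g^{KPSD}_{Δ,ℓ} = (-1)^ℓ κ_{Δ,ℓ} g_{Δ,ℓ}` (`κ > 0`), rewritten for
the blocks of A2 and divided by the positive constant: the parity sign lands on the `a = -b` family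
`g₁` (ERRATUM 2026-08-19, `SigmaEpsilonData.SatisfiesCrossing`; before, the tree carried the verbatim
placement, i.e. `(-1)^ℓ` times this form). With this placement the reflection-positive `⟨εσσε⟩`
entries `α⁴, α⁵` see the non-negative double series `g₂` with coefficient `+λ²` for both parities,
and the unitarity-bound residue of `V⃗_{-,Δ,ℓ}` is a positive multiple of `V⃗_{-,ℓ+2,ℓ-1}`.
(Kos–Poland–Simmons-Duffin 2014, §3.2 eq. (3.13)–(3.14).) [cite: KosPolandSimmonsduffin2014, §3.2 eq. (3.13)] -/
noncomputable def oddForm (α : CrossingFunctional) (Δσ Δε : ℝ) (ℓ : ℕ) (g₁ g₂ : ℝ → ℝ → ℝ) : ℝ :=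
  (-1 : ℝ) ^ ℓ * α.α₃ (crossF ((Δσ + Δε) / 2) (-1) g₁) + α.α₄ (crossF Δσ (-1) g₂)
    - α.α₅ (crossF Δσ 1 g₂)

/-- **The positivity conditions of a dual functional at the external point `(Δ_σ, Δ_ε)`**
(Kos–Poland–Simmons-Duffin 2014, §3.3 eq. (3.16)): (i) the identity term is `> 0`; (ii) for
every `ℤ₂`-even exchanged operator allowed by A1 and A4 — even spin `ℓ`, `Δ ≥` the unitarity
bound, and if `ℓ = 0` and `Δ < 3` then `Δ = Δ_ε` — and EVERY function `g` that is the genuine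
block `g^{0,0}_{Δ,ℓ}` (`IsConformalBlock3D 0 0 Δ ℓ g`), the quadratic form `evenForm` is
non-negative (`α⃗·V⃗₊ ⪰ 0`); (iii) for every `ℤ₂`-odd exchanged operator allowed by A1 and A4 —
any spin, `Δ ≥` the bound, scalars below `3` only at `Δ_σ` — and every pair of genuine blocks
`g^{±Δ_σε,Δ_σε}_{Δ,ℓ}` (`Δ_σε = Δ_σ - Δ_ε`), `oddForm ≥ 0` (`α⃗·V⃗₋ ≥ 0`). The spectrum
conditions are copied literally from `SatisfiesUnitarity` / `OnlySigmaEpsilonRelevant`, so the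
hypothesis is exactly as strong as the numerics' "assumption about the spectrum" and no stronger.
[cite: KosPolandSimmonsduffin2014, §3.3 eq. (3.16)] -/
def IsPositiveAt (α : CrossingFunctional) (Δσ Δε : ℝ) : Prop :=
  0 < α.identityTerm Δσ Δε ∧
    (∀ (Δ : ℝ) (ℓ : ℕ) (g : ℝ → ℝ → ℝ), Even ℓ → unitarityBound3D ℓ ≤ Δ →
        (ℓ = 0 → Δ < 3 → Δ = Δε) → IsConformalBlock3D 0 0 Δ ℓ g →
          ∀ a b : ℝ, 0 ≤ α.evenForm Δσ Δε g a b) ∧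
      ∀ (Δ : ℝ) (ℓ : ℕ) (g₁ g₂ : ℝ → ℝ → ℝ), unitarityBound3D ℓ ≤ Δ →
        (ℓ = 0 → Δ < 3 → Δ = Δσ) → IsConformalBlock3D (Δσ - Δε) (Δσ - Δε) Δ ℓ g₁ →
          IsConformalBlock3D (-(Δσ - Δε)) (Δσ - Δε) Δ ℓ g₂ → 0 ≤ α.oddForm Δσ Δε ℓ g₁ g₂

/-- **Termwise action (REFEREE.md T4) of `α⃗` on the datum `D`**: applying `αⁱ` to the `i`-th sum
rule of `D.SatisfiesCrossing` term by term yields convergent real series with the functional of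
the right-hand side as sum — rules 1–3 literally, rules 4–5 with the even and odd parts summed
separately exactly as in `SatisfiesCrossing`. This is the sole analytic input of the dual
argument; it is a THEOREM for evaluation-continuous functionals
(`appliesTermwise_of_isEvaluationContinuous`) and an open obligation for derivative functionals.
(Kos–Poland–Simmons-Duffin 2014, §3.2 eq. (3.13)–(3.15): "Acting on (3.11) with this
functional gives the dual form of crossing equation".) [cite: KosPolandSimmonsduffin2014, §3.2 eq. (3.13)–(3.15)] -/
def AppliesTermwise (α : CrossingFunctional) (D : SigmaEpsilonData) : Prop :=
  HasSum (fun i => D.lamσσ i ^ 2 * α.α₁ (crossF D.Δσ (-1) (D.gp i)))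
      (-(α.α₁ (crossF D.Δσ (-1) (fun _ _ => (1 : ℝ))))) ∧
    HasSum (fun i => D.lamεε i ^ 2 * α.α₂ (crossF D.Δε (-1) (D.gp i)))
        (-(α.α₂ (crossF D.Δε (-1) (fun _ _ => (1 : ℝ))))) ∧
      HasSum (fun j => (-1 : ℝ) ^ D.ℓm j * D.lamσε j ^ 2 *
          α.α₃ (crossF ((D.Δσ + D.Δε) / 2) (-1) (D.gmm j))) 0 ∧
        (∃ Sp Sm : ℝ,
          HasSum (fun i => D.lamσσ i * D.lamεε i *
              α.α₄ (crossF ((D.Δσ + D.Δε) / 2) (-1) (D.gp i))) Sp ∧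
            HasSum (fun j => D.lamσε j ^ 2 * α.α₄ (crossF D.Δσ (-1) (D.gpm j))) Sm ∧
              α.α₄ (crossF ((D.Δσ + D.Δε) / 2) (-1) (fun _ _ => (1 : ℝ))) + Sp + Sm = 0) ∧
          ∃ Sp Sm : ℝ,
            HasSum (fun i => D.lamσσ i * D.lamεε i *
                α.α₅ (crossF ((D.Δσ + D.Δε) / 2) 1 (D.gp i))) Sp ∧
              HasSum (fun j => D.lamσε j ^ 2 * α.α₅ (crossF D.Δσ 1 (D.gpm j))) Sm ∧
                α.α₅ (crossF ((D.Δσ + D.Δε) / 2) 1 (fun _ _ => (1 : ℝ))) + Sp - Sm = 0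

/-- **The dual-functional argument** (Rattazzi–Rychkov–Tonni–Vichi 2008, §5;
Kos–Poland–Simmons-Duffin 2014, §3.3: "If we manage to find such a functional, then crossing
symmetry can not be satisfied"), PROVED: a datum satisfying A1 (unitarity bounds, even spins),
A2 (genuine blocks) and A4 (gaps), on which `α⃗` acts termwise, cannot have `α⃗` positive at its
own `(Δ_σ, Δ_ε)`. Proof: apply `αⁱ` to rule `i` and add; the even-sector series
`∑_{𝒪⁺} (λ_σσ𝒪 λ_εε𝒪) α⃗·V⃗₊ (λ_σσ𝒪 λ_εε𝒪)ᵀ` and the odd-sector series `∑_{𝒪⁻} λ_σε𝒪² α⃗·V⃗₋` have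
non-negative terms, hence non-negative sums, and the sums add up to minus the identity term,
which is positive. [cite: KosPolandSimmonsduffin2014, §3.3 eq. (3.16)]
[cite: RattazziEtAl2008, §5] -/
theorem not_isPositiveAt_of_appliesTermwise (α : CrossingFunctional) (D : SigmaEpsilonData)
    (hU : D.SatisfiesUnitarity) (hB : D.HasGenuineBlocks) (hG : D.OnlySigmaEpsilonRelevant)
    (hT : α.AppliesTermwise D) (hpos : α.IsPositiveAt D.Δσ D.Δε) : False := by
  obtain ⟨h1, h2, h3, ⟨Sp, Sm, h4p, h4m, h4e⟩, ⟨Sp', Sm', h5p, h5m, h5e⟩⟩ := hT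
  obtain ⟨hI, hev, hodd⟩ := hpos
  obtain ⟨_, _, hbp, hevs, hbm⟩ := hU
  obtain ⟨hgp, hgmm, hgpm⟩ := hB
  obtain ⟨hgapm, hgapp⟩ := hG
  -- the even-sector series, term by term the quadratic form at `(λ_σσ𝒪, λ_εε𝒪)`
  have hE : HasSum (fun i => α.evenForm D.Δσ D.Δε (D.gp i) (D.lamσσ i) (D.lamεε i))
      (-(α.α₁ (crossF D.Δσ (-1) (fun _ _ => (1 : ℝ))))
        + -(α.α₂ (crossF D.Δε (-1) (fun _ _ => (1 : ℝ)))) + (Sp + Sp')) := by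
    have hs := (h1.add h2).add (h4p.add h5p)
    refine hs.congr_fun ?_
    intro i
    simp only [evenForm]
    ring
  have hEnn : 0 ≤ -(α.α₁ (crossF D.Δσ (-1) (fun _ _ => (1 : ℝ))))
      + -(α.α₂ (crossF D.Δε (-1) (fun _ _ => (1 : ℝ)))) + (Sp + Sp') :=
    hE.nonneg fun i =>
      hev (D.Δp i) (D.ℓp i) (D.gp i) (hevs i) (hbp i) (hgapp i) (hgp i) (D.lamσσ i) (D.lamεε i)
  -- the odd-sector series, term by term `λ_σε𝒪² α⃗·V⃗₋`
  have hO : HasSum (fun j => D.lamσε j ^ 2 * α.oddForm D.Δσ D.Δε (D.ℓm j) (D.gmm j) (D.gpm j))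
      (0 + Sm - Sm') := by
    have hs := (h3.add h4m).sub h5m
    refine hs.congr_fun ?_
    intro j
    simp only [oddForm]
    ring
  have hOnn : 0 ≤ 0 + Sm - Sm' :=
    hO.nonneg fun j =>
      mul_nonneg (sq_nonneg _)
        (hodd (D.Δm j) (D.ℓm j) (D.gmm j) (D.gpm j) (hbm j) (hgapm j) (hgmm j) (hgpm j))
  unfold identityTerm at hI
  linarith

end CrossingFunctional

/-! ### Evaluation-continuous functionals: termwise action is automatic -/

/-- A real-linear functional `φ` on functions of `(z, z̄)` is *evaluation-continuous* if it maps
every family that is summable POINTWISE ON THE OPEN SQUARE `z, z̄ ∈ (0,1)`, with pointwise sum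
`S` there, to a summable real family with sum `φ S`. Such a `φ` depends only on the values on the
square (`EvaluationContinuous.eq_of_eqOn`). Finite linear combinations of point evaluations are
the examples (`evaluationContinuous_pointFunctional`); derivative functionals are not.
Elementary. [folklore] -/
def EvaluationContinuous (φ : (ℝ → ℝ → ℝ) →ₗ[ℝ] ℝ) : Prop :=
  ∀ (ι : Type) (f : ι → ℝ → ℝ → ℝ) (S : ℝ → ℝ → ℝ),
    (∀ z zb : ℝ, z ∈ Ioo (0 : ℝ) 1 → zb ∈ Ioo (0 : ℝ) 1 → HasSum (fun i => f i z zb) (S z zb)) →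
      HasSum (fun i => φ (f i)) (φ S)

namespace EvaluationContinuous

variable {φ : (ℝ → ℝ → ℝ) →ₗ[ℝ] ℝ}

/-- An evaluation-continuous functional takes equal values on functions that agree on the open
square. Elementary (one-term family). [folklore] -/
theorem eq_of_eqOn (hφ : EvaluationContinuous φ) {S S' : ℝ → ℝ → ℝ}
    (h : ∀ z zb : ℝ, z ∈ Ioo (0 : ℝ) 1 → zb ∈ Ioo (0 : ℝ) 1 → S z zb = S' z zb) : φ S = φ S' := by
  have hs := hφ Unit (fun _ => S) S' (fun z zb hz hzb => by
    simp [h z zb hz hzb])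
  have := (hasSum_fintype (fun _ : Unit => φ S)).unique hs
  simpa using this

/-- Termwise action on a series with scalar weights: if `∑ᵢ cᵢ Fᵢ(z,z̄) = S(z,z̄)` pointwise on
the square then `∑ᵢ cᵢ φ(Fᵢ) = φ(S)`. Elementary (linearity). [folklore] -/
theorem hasSum_mul (hφ : EvaluationContinuous φ) {ι : Type} (c : ι → ℝ) (F : ι → ℝ → ℝ → ℝ)
    (S : ℝ → ℝ → ℝ)
    (h : ∀ z zb : ℝ, z ∈ Ioo (0 : ℝ) 1 → zb ∈ Ioo (0 : ℝ) 1 →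
      HasSum (fun i => c i * F i z zb) (S z zb)) :
    HasSum (fun i => c i * φ (F i)) (φ S) := by
  have hs := hφ ι (fun i => c i • F i) S (fun z zb hz hzb => by
    simpa [Pi.smul_apply, smul_eq_mul] using h z zb hz hzb)
  simpa [map_smul, smul_eq_mul] using hs

/-- Termwise action when the pointwise sums are only known to exist: the sum function may be
taken to be `fun z z̄ => ∑' i, cᵢ Fᵢ(z,z̄)`. Elementary. [folklore] -/
theorem hasSum_mul_tsum (hφ : EvaluationContinuous φ) {ι : Type} (c : ι → ℝ)
    (F : ι → ℝ → ℝ → ℝ)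
    (h : ∀ z zb : ℝ, z ∈ Ioo (0 : ℝ) 1 → zb ∈ Ioo (0 : ℝ) 1 →
      Summable (fun i => c i * F i z zb)) :
    HasSum (fun i => c i * φ (F i)) (φ (fun z zb => ∑' i, c i * F i z zb)) :=
  hφ.hasSum_mul c F _ fun z zb hz hzb => (h z zb hz hzb).hasSum

end EvaluationContinuous

namespace CrossingFunctional

/-- All five components of `α⃗` are evaluation-continuous. [folklore] -/
def IsEvaluationContinuous (α : CrossingFunctional) : Prop :=
  EvaluationContinuous α.α₁ ∧ EvaluationContinuous α.α₂ ∧ EvaluationContinuous α.α₃ ∧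
    EvaluationContinuous α.α₄ ∧ EvaluationContinuous α.α₅

/-- **T4 for evaluation-continuous functionals**: the crossing axiom A3 alone (five `HasSum`
identities at every point of the square) implies termwise action. For rules 4–5 the even and odd
part sums are the pointwise `tsum`s, and the scalar identity `αⁱ[F_𝟙] + Sp ± Sm = 0` follows
because an evaluation-continuous functional only sees the square, where the three functions add
up to `0`. Elementary. [folklore] -/
theorem appliesTermwise_of_isEvaluationContinuous (α : CrossingFunctional)
    (hα : α.IsEvaluationContinuous) (D : SigmaEpsilonData) (hC : D.SatisfiesCrossing) :
    α.AppliesTermwise D := by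
  obtain ⟨hα1, hα2, hα3, hα4, hα5⟩ := hα
  refine ⟨?_, ?_, ?_, ?_, ?_⟩
  · -- rule 1
    have hs := hα1.hasSum_mul (fun i => D.lamσσ i ^ 2) (fun i => crossF D.Δσ (-1) (D.gp i))
      (fun z zb => -(crossF D.Δσ (-1) (fun _ _ => (1 : ℝ)) z zb))
      (fun z zb hz hzb => (hC z zb hz hzb).1)
    have hneg : α.α₁ (fun z zb => -(crossF D.Δσ (-1) (fun _ _ => (1 : ℝ)) z zb))
        = -(α.α₁ (crossF D.Δσ (-1) (fun _ _ => (1 : ℝ)))) := by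
      rw [← map_neg]; rfl
    simpa [hneg] using hs
  · -- rule 2
    have hs := hα2.hasSum_mul (fun i => D.lamεε i ^ 2) (fun i => crossF D.Δε (-1) (D.gp i))
      (fun z zb => -(crossF D.Δε (-1) (fun _ _ => (1 : ℝ)) z zb))
      (fun z zb hz hzb => (hC z zb hz hzb).2.1)
    have hneg : α.α₂ (fun z zb => -(crossF D.Δε (-1) (fun _ _ => (1 : ℝ)) z zb))
        = -(α.α₂ (crossF D.Δε (-1) (fun _ _ => (1 : ℝ)))) := by
      rw [← map_neg]; rfl
    simpa [hneg] using hs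
  · -- rule 3
    have hs := hα3.hasSum_mul (fun j => (-1 : ℝ) ^ D.ℓm j * D.lamσε j ^ 2)
      (fun j => crossF ((D.Δσ + D.Δε) / 2) (-1) (D.gmm j)) (fun _ _ => 0)
      (fun z zb hz hzb => (hC z zb hz hzb).2.2.1)
    have h0 : α.α₃ (fun _ _ => (0 : ℝ)) = 0 := map_zero α.α₃
    simpa [h0] using hs
  · -- rule 4: even part, odd part, and the scalar identity
    have hsumP : ∀ z zb : ℝ, z ∈ Ioo (0 : ℝ) 1 → zb ∈ Ioo (0 : ℝ) 1 →
        Summable (fun i => (D.lamσσ i * D.lamεε i) *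
          crossF ((D.Δσ + D.Δε) / 2) (-1) (D.gp i) z zb) := by
      intro z zb hz hzb
      obtain ⟨Sp, Sm, hp, _, _⟩ := (hC z zb hz hzb).2.2.2.1
      exact hp.summable
    have hsumM : ∀ z zb : ℝ, z ∈ Ioo (0 : ℝ) 1 → zb ∈ Ioo (0 : ℝ) 1 →
        Summable (fun j => (D.lamσε j ^ 2) *
          crossF D.Δσ (-1) (D.gpm j) z zb) := by
      intro z zb hz hzb
      obtain ⟨Sp, Sm, _, hm, _⟩ := (hC z zb hz hzb).2.2.2.1
      exact hm.summable
    refine ⟨_, _, hα4.hasSum_mul_tsum _ _ hsumP, hα4.hasSum_mul_tsum _ _ hsumM, ?_⟩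
    -- on the square the three functions add up to zero
    have hzero : α.α₄ (crossF ((D.Δσ + D.Δε) / 2) (-1) (fun _ _ => (1 : ℝ))
        + (fun z zb => ∑' i, (D.lamσσ i * D.lamεε i) *
            crossF ((D.Δσ + D.Δε) / 2) (-1) (D.gp i) z zb)
        + (fun z zb => ∑' j, (D.lamσε j ^ 2) *
            crossF D.Δσ (-1) (D.gpm j) z zb)) = α.α₄ (fun _ _ => (0 : ℝ)) := by
      refine hα4.eq_of_eqOn ?_
      intro z zb hz hzb
      obtain ⟨Sp, Sm, hp, hm, he⟩ := (hC z zb hz hzb).2.2.2.1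
      simp only [Pi.add_apply]
      rw [hp.tsum_eq, hm.tsum_eq]
      exact he
    have h0 : α.α₄ (fun _ _ => (0 : ℝ)) = 0 := map_zero α.α₄
    rw [map_add, map_add, h0] at hzero
    exact hzero
  · -- rule 5: even part, odd part, and the scalar identity (with the minus sign)
    have hsumP : ∀ z zb : ℝ, z ∈ Ioo (0 : ℝ) 1 → zb ∈ Ioo (0 : ℝ) 1 →
        Summable (fun i => (D.lamσσ i * D.lamεε i) *
          crossF ((D.Δσ + D.Δε) / 2) 1 (D.gp i) z zb) := by
      intro z zb hz hzb
      obtain ⟨Sp, Sm, hp, _, _⟩ := (hC z zb hz hzb).2.2.2.2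
      exact hp.summable
    have hsumM : ∀ z zb : ℝ, z ∈ Ioo (0 : ℝ) 1 → zb ∈ Ioo (0 : ℝ) 1 →
        Summable (fun j => (D.lamσε j ^ 2) *
          crossF D.Δσ 1 (D.gpm j) z zb) := by
      intro z zb hz hzb
      obtain ⟨Sp, Sm, _, hm, _⟩ := (hC z zb hz hzb).2.2.2.2
      exact hm.summable
    refine ⟨_, _, hα5.hasSum_mul_tsum _ _ hsumP, hα5.hasSum_mul_tsum _ _ hsumM, ?_⟩
    have hzero : α.α₅ (crossF ((D.Δσ + D.Δε) / 2) 1 (fun _ _ => (1 : ℝ))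
        + (fun z zb => ∑' i, (D.lamσσ i * D.lamεε i) *
            crossF ((D.Δσ + D.Δε) / 2) 1 (D.gp i) z zb)
        - (fun z zb => ∑' j, (D.lamσε j ^ 2) *
            crossF D.Δσ 1 (D.gpm j) z zb)) = α.α₅ (fun _ _ => (0 : ℝ)) := by
      refine hα5.eq_of_eqOn ?_
      intro z zb hz hzb
      obtain ⟨Sp, Sm, hp, hm, he⟩ := (hC z zb hz hzb).2.2.2.2
      simp only [Pi.add_apply, Pi.sub_apply]
      rw [hp.tsum_eq, hm.tsum_eq]
      exact he
    have h0 : α.α₅ (fun _ _ => (0 : ℝ)) = 0 := map_zero α.α₅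
    rw [map_sub, map_add, h0] at hzero
    exact hzero

/-- **Box-uniform exclusion by one functional** (REFEREE.md F3): if `α⃗` is evaluation-continuous
and positive (eq. (3.16)) at EVERY point of `Q`, then no datum satisfying the typed axioms A1–A4
has `(Δ_σ, Δ_ε) ∈ Q` — `BoxExcluded Q`. (Kos–Poland–Simmons-Duffin 2014, §3.3 eq. (3.16), with
termwise action proved rather than assumed.) [cite: KosPolandSimmonsduffin2014, §3.3 eq. (3.16)] -/
theorem boxExcluded_of_functional (Q : Set (ℝ × ℝ)) (α : CrossingFunctional)
    (hα : α.IsEvaluationContinuous) (hpos : ∀ p ∈ Q, α.IsPositiveAt p.1 p.2) :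
    BoxExcluded Q := by
  intro D hD hQ
  obtain ⟨hB, hU, _, hC, hG⟩ := hD
  exact not_isPositiveAt_of_appliesTermwise α D hU hB hG
    (appliesTermwise_of_isEvaluationContinuous α hα D hC) (hpos _ hQ)

end CrossingFunctional

/-- A smaller set than an excluded one is excluded. Elementary. [folklore] -/
theorem BoxExcluded.mono {Q Q' : Set (ℝ × ℝ)} (h : BoxExcluded Q) (hQ' : Q' ⊆ Q) :
    BoxExcluded Q' :=
  fun D hD hmem => h D hD (hQ' hmem)

/-! ### Point-evaluation functionals -/

/-- The point-evaluation functional `F ↦ ∑_k w_k F(z_k, z̄_k)` with finitely many nodes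
`(z_k, z̄_k)` and real weights `w_k` (a rational certificate instantiates them with rationals).
Imposing crossing point by point at several `z = z_i` and deciding feasibility by linear
programming: Hogervorst–Rychkov 2013, §4.3; by finite differences such functionals span the
derivative functionals of Kos–Poland–Simmons-Duffin 2014, eq. (3.17), in the limit.
[cite: HogervorstRychkov2013, §4.3] -/
noncomputable def pointFunctional {n : ℕ} (w z zb : Fin n → ℝ) : (ℝ → ℝ → ℝ) →ₗ[ℝ] ℝ where
  toFun F := ∑ k, w k * F (z k) (zb k)
  map_add' F G := by
    simp only [Pi.add_apply, mul_add, Finset.sum_add_distrib]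
  map_smul' c F := by
    simp only [Pi.smul_apply, smul_eq_mul, RingHom.id_apply, Finset.mul_sum]
    refine Finset.sum_congr rfl fun k _ => ?_
    ring

/-- Unfolding lemma. [folklore] -/
theorem pointFunctional_apply {n : ℕ} (w z zb : Fin n → ℝ) (F : ℝ → ℝ → ℝ) :
    pointFunctional w z zb F = ∑ k, w k * F (z k) (zb k) := rfl

/-- A point-evaluation functional whose nodes lie in the open square is evaluation-continuous
(a finite sum of convergent series converges to the sum of the sums). Elementary. [folklore] -/
theorem evaluationContinuous_pointFunctional {n : ℕ} (w z zb : Fin n → ℝ)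
    (hz : ∀ k, z k ∈ Ioo (0 : ℝ) 1) (hzb : ∀ k, zb k ∈ Ioo (0 : ℝ) 1) :
    EvaluationContinuous (pointFunctional w z zb) := by
  intro ι f S h
  simp only [pointFunctional_apply]
  exact hasSum_sum fun k _ => (h (z k) (zb k) (hz k) (hzb k)).mul_left (w k)

namespace CrossingFunctional

/-- The 5-vector of point-evaluation functionals on common nodes `(z_k, z̄_k)` with weight table
`w : Fin 5 → Fin n → ℝ` (`w 0` for `α¹`, …, `w 4` for `α⁵`). [folklore] -/
noncomputable def ofPoints {n : ℕ} (z zb : Fin n → ℝ) (w : Fin 5 → Fin n → ℝ) :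
    CrossingFunctional where
  α₁ := pointFunctional (w 0) z zb
  α₂ := pointFunctional (w 1) z zb
  α₃ := pointFunctional (w 2) z zb
  α₄ := pointFunctional (w 3) z zb
  α₅ := pointFunctional (w 4) z zb

/-- Point-evaluation 5-vectors with nodes in the open square are evaluation-continuous. [folklore] -/
theorem isEvaluationContinuous_ofPoints {n : ℕ} (z zb : Fin n → ℝ) (w : Fin 5 → Fin n → ℝ)
    (hz : ∀ k, z k ∈ Ioo (0 : ℝ) 1) (hzb : ∀ k, zb k ∈ Ioo (0 : ℝ) 1) :
    (ofPoints z zb w).IsEvaluationContinuous :=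
  ⟨evaluationContinuous_pointFunctional _ z zb hz hzb,
    evaluationContinuous_pointFunctional _ z zb hz hzb,
    evaluationContinuous_pointFunctional _ z zb hz hzb,
    evaluationContinuous_pointFunctional _ z zb hz hzb,
    evaluationContinuous_pointFunctional _ z zb hz hzb⟩

/-- **What one certificate proves.** A point-evaluation functional with nodes in the open square,
positive (eq. (3.16)) at every `(Δ_σ, Δ_ε) ∈ Q`, excludes `Q`: no `σ–ε` datum satisfying the
typed bootstrap axioms A1–A4 has `(Δ_σ, Δ_ε) ∈ Q`. Fully proved; the remaining burden of a
certificate is the hypothesis `hpos` (positivity on every genuine block, box-uniformly — REFEREE.md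
T1–T3). [cite: KosPolandSimmonsduffin2014, §3.3 eq. (3.16)] -/
theorem boxExcluded_of_pointFunctional {n : ℕ} (z zb : Fin n → ℝ) (w : Fin 5 → Fin n → ℝ)
    (hz : ∀ k, z k ∈ Ioo (0 : ℝ) 1) (hzb : ∀ k, zb k ∈ Ioo (0 : ℝ) 1) (Q : Set (ℝ × ℝ))
    (hpos : ∀ p ∈ Q, (ofPoints z zb w).IsPositiveAt p.1 p.2) : BoxExcluded Q :=
  boxExcluded_of_functional Q _ (isEvaluationContinuous_ofPoints z zb w hz hzb) hpos

end CrossingFunctional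

/-! ### The single-correlator special case (`⟨σσσσ⟩` only) -/

namespace CrossingFunctional

/-- The single-correlator functional: only `α¹` (acting on sum rule 1, `⟨σσσσ⟩`) is non-zero —
the setting of the original bound of Rattazzi–Rychkov–Tonni–Vichi 2008 and of the `Δ_ε` upper
bound of El-Showk et al. 2012, here inside the `σ–ε` system (the gap A4(b) on the scalars of
`σ×σ` is still available to it). [cite: ElShowkEtAl2012, §5] -/
def single (φ : (ℝ → ℝ → ℝ) →ₗ[ℝ] ℝ) : CrossingFunctional :=
  ⟨φ, 0, 0, 0, 0⟩

/-- Positivity of a single-correlator functional reduces to the linear-programming conditions of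
Rattazzi–Rychkov–Tonni–Vichi 2008, §5: `φ[F^{σσ,σσ}_{-,𝟙}] > 0` and `φ[F^{σσ,σσ}_{-,Δ,ℓ}] ≥ 0`
for every `ℤ₂`-even `(Δ, ℓ)` allowed in `σ×σ` by A1/A4 and every genuine block `g^{0,0}_{Δ,ℓ}`
(the odd sector imposes nothing). Elementary. [cite: RattazziEtAl2008, §5] -/
theorem isPositiveAt_single (φ : (ℝ → ℝ → ℝ) →ₗ[ℝ] ℝ) (Δσ Δε : ℝ)
    (hI : 0 < φ (crossF Δσ (-1) (fun _ _ => (1 : ℝ))))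
    (hpos : ∀ (Δ : ℝ) (ℓ : ℕ) (g : ℝ → ℝ → ℝ), Even ℓ → unitarityBound3D ℓ ≤ Δ →
      (ℓ = 0 → Δ < 3 → Δ = Δε) → IsConformalBlock3D 0 0 Δ ℓ g → 0 ≤ φ (crossF Δσ (-1) g)) :
    (single φ).IsPositiveAt Δσ Δε := by
  refine ⟨?_, ?_, ?_⟩
  · simpa [identityTerm, single] using hI
  · intro Δ ℓ g hℓ hb hgap hg a b
    have h := hpos Δ ℓ g hℓ hb hgap hg
    simp only [evenForm, single, LinearMap.zero_apply, mul_zero, add_zero]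
    exact mul_nonneg (sq_nonneg a) h
  · intro Δ ℓ g₁ g₂ _ _ _ _
    simp [oddForm, single]

/-- **Single-correlator certificate.** A point-evaluation functional `φ = ∑_k w_k ev_{(z_k, z̄_k)}`
with nodes in the open square such that, for every `(Δ_σ, Δ_ε) ∈ Q`, `φ[F^{σσ,σσ}_{-,𝟙}] > 0` and
`φ[F^{σσ,σσ}_{-,Δ,ℓ}] ≥ 0` on every genuine block allowed in `σ×σ` (even `ℓ`, unitarity bound,
scalars below `3` only at `Δ_ε`), excludes `Q`. This is the shape of the first end-to-end
certified exclusion (REFEREE.md F12 (C)). [cite: KosPolandSimmonsduffin2014, §3.3 eq. (3.16)] -/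
theorem boxExcluded_of_singleCorrelatorPoints {n : ℕ} (w z zb : Fin n → ℝ)
    (hz : ∀ k, z k ∈ Ioo (0 : ℝ) 1) (hzb : ∀ k, zb k ∈ Ioo (0 : ℝ) 1) (Q : Set (ℝ × ℝ))
    (hI : ∀ p ∈ Q, 0 < pointFunctional w z zb (crossF p.1 (-1) (fun _ _ => (1 : ℝ))))
    (hpos : ∀ p ∈ Q, ∀ (Δ : ℝ) (ℓ : ℕ) (g : ℝ → ℝ → ℝ), Even ℓ → unitarityBound3D ℓ ≤ Δ →
      (ℓ = 0 → Δ < 3 → Δ = p.2) → IsConformalBlock3D 0 0 Δ ℓ g →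
        0 ≤ pointFunctional w z zb (crossF p.1 (-1) g)) :
    BoxExcluded Q := by
  refine boxExcluded_of_functional Q (single (pointFunctional w z zb)) ?_ ?_
  · have h0 : EvaluationContinuous (0 : (ℝ → ℝ → ℝ) →ₗ[ℝ] ℝ) := by
      intro ι f S _
      simp only [LinearMap.zero_apply]
      exact hasSum_zero
    exact ⟨evaluationContinuous_pointFunctional w z zb hz hzb, h0, h0, h0, h0⟩
  · intro p hp
    exact isPositiveAt_single _ p.1 p.2 (hI p hp) (hpos p hp)

end CrossingFunctional

/-! ### The `2×2` positive-semidefiniteness criterion used by certificate checkers -/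

/-- A real symmetric `2×2` matrix `[[X, Z/2], [Z/2, Y]]` with `X, Y ≥ 0` and `Z² ≤ 4XY` is
positive semidefinite: `a²X + b²Y + abZ ≥ 0` for all `a, b` (since `4X(a²X + b²Y + abZ)
= (2Xa + Zb)² + b²(4XY - Z²)`). This turns the three entrywise inequalities a rational certificate
checks into the quadratic-form condition of `CrossingFunctional.IsPositiveAt`. Elementary. [folklore] -/
theorem quadForm_nonneg_of_det {X Y Z : ℝ} (hX : 0 ≤ X) (hY : 0 ≤ Y) (hZ : Z ^ 2 ≤ 4 * X * Y)
    (a b : ℝ) : 0 ≤ a ^ 2 * X + b ^ 2 * Y + a * b * Z := by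
  rcases hX.eq_or_lt with hX0 | hXpos
  · -- `X = 0` forces `Z = 0`
    subst hX0
    have hZ0 : Z = 0 := by nlinarith [sq_nonneg Z]
    subst hZ0
    nlinarith [sq_nonneg b]
  · have key : 4 * X * (a ^ 2 * X + b ^ 2 * Y + a * b * Z)
        = (2 * X * a + Z * b) ^ 2 + b ^ 2 * (4 * X * Y - Z ^ 2) := by ring
    have hR : 0 ≤ (2 * X * a + Z * b) ^ 2 + b ^ 2 * (4 * X * Y - Z ^ 2) := by
      have h1 := sq_nonneg (2 * X * a + Z * b)
      have h2 : 0 ≤ b ^ 2 * (4 * X * Y - Z ^ 2) := mul_nonneg (sq_nonneg b) (by linarith)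
      linarith
    rcases le_or_gt 0 (a ^ 2 * X + b ^ 2 * Y + a * b * Z) with hge | hneg
    · exact hge
    · exfalso
      have : 4 * X * (a ^ 2 * X + b ^ 2 * Y + a * b * Z) < 0 :=
        mul_neg_of_pos_of_neg (by linarith) hneg
      linarith

/-- Entrywise form of the even-sector condition: if at `(Δ_σ, Δ_ε)` and for the block `g` the
three numbers `X = α¹[F^{σσ,σσ}_-]`, `Y = α²[F^{εε,εε}_-]`, `Z = α⁴[F^{σσ,εε}_-] + α⁵[F^{σσ,εε}_+]`
satisfy `X, Y ≥ 0`, `Z² ≤ 4XY`, then `evenForm ≥ 0` for all `(a, b)`. Elementary. [folklore] -/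
theorem CrossingFunctional.evenForm_nonneg_of_det (α : CrossingFunctional) (Δσ Δε : ℝ)
    (g : ℝ → ℝ → ℝ) (hX : 0 ≤ α.α₁ (crossF Δσ (-1) g)) (hY : 0 ≤ α.α₂ (crossF Δε (-1) g))
    (hZ : (α.α₄ (crossF ((Δσ + Δε) / 2) (-1) g) + α.α₅ (crossF ((Δσ + Δε) / 2) 1 g)) ^ 2
      ≤ 4 * α.α₁ (crossF Δσ (-1) g) * α.α₂ (crossF Δε (-1) g)) (a b : ℝ) :
    0 ≤ α.evenForm Δσ Δε g a b := by
  unfold CrossingFunctional.evenForm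
  exact quadForm_nonneg_of_det hX hY hZ a b

/-! ### Assembly of finitely many certificates on a product grid -/

/-- Discrete intermediate-value step: if `x₀ ≤ t ≤ x_N` (`N ≥ 1`) then `t` lies in one of the
closed steps `[x_k, x_{k+1}]`, `k < N` (no monotonicity needed: take the largest `k ≤ N-1` with
`x_k ≤ t`). Elementary. [folklore] -/
theorem exists_step_of_mem_Icc (x : ℕ → ℝ) {N : ℕ} (hN : 1 ≤ N) {t : ℝ} (h0 : x 0 ≤ t)
    (hN' : t ≤ x N) : ∃ k, k < N ∧ x k ≤ t ∧ t ≤ x (k + 1) := by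
  classical
  set k := Nat.findGreatest (fun k => x k ≤ t) (N - 1) with hk
  have hkle : k ≤ N - 1 := Nat.findGreatest_le (N - 1)
  have hkspec : x k ≤ t := Nat.findGreatest_spec (P := fun k => x k ≤ t) (Nat.zero_le _) h0
  refine ⟨k, by omega, hkspec, ?_⟩
  by_cases hlast : k + 1 ≤ N - 1
  · have hnot : ¬ x (k + 1) ≤ t :=
      Nat.findGreatest_is_greatest (P := fun k => x k ≤ t) (Nat.lt_succ_self k) hlast
    exact le_of_lt (lt_of_not_ge hnot)
  · have : k + 1 = N := by omega
    rw [this]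
    exact hN'

/-- A closed rectangle `[x₀, x_N] × [y₀, y_M]` (`N, M ≥ 1`) is covered by the closed grid cells
`[x_k, x_{k+1}] × [y_m, y_{m+1}]`, `k < N`, `m < M`. Elementary. [folklore] -/
theorem Icc_prod_subset_iUnion_cells (x y : ℕ → ℝ) {N M : ℕ} (hN : 1 ≤ N) (hM : 1 ≤ M) :
    Icc (x 0) (x N) ×ˢ Icc (y 0) (y M) ⊆
      ⋃ k ∈ Finset.range N, ⋃ m ∈ Finset.range M,
        Icc (x k) (x (k + 1)) ×ˢ Icc (y m) (y (m + 1)) := by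
  rintro ⟨s, t⟩ ⟨⟨hs0, hsN⟩, ⟨ht0, htM⟩⟩
  obtain ⟨k, hk, hk1, hk2⟩ := exists_step_of_mem_Icc x hN hs0 hsN
  obtain ⟨m, hm, hm1, hm2⟩ := exists_step_of_mem_Icc y hM ht0 htM
  simp only [mem_iUnion, Finset.mem_range, mem_prod, mem_Icc, exists_prop]
  exact ⟨k, hk, m, hm, ⟨hk1, hk2⟩, ⟨hm1, hm2⟩⟩

/-- **Assembly of a certificate family on a product grid** (REFEREE.md T5 / F3): let the window be
`W = [x₀, x_N] × [y₀, y_M]` with grid abscissae `x_k`, ordinates `y_m` (a certificate uses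
rationals). If every grid cell is either contained in the region `R` or excluded
(`BoxExcluded`, one certified functional per cell), then `IsingEnclosure W R`: every `σ–ε` datum
satisfying the typed axioms with `(Δ_σ, Δ_ε) ∈ W` has `(Δ_σ, Δ_ε) ∈ R`. (Cells of an excluded
larger box may cite it through `BoxExcluded.mono`.) Elementary. [folklore] -/
theorem isingEnclosure_of_grid (x y : ℕ → ℝ) {N M : ℕ} (hN : 1 ≤ N) (hM : 1 ≤ M)
    (R : Set (ℝ × ℝ))
    (hcell : ∀ k, k < N → ∀ m, m < M →
      Icc (x k) (x (k + 1)) ×ˢ Icc (y m) (y (m + 1)) ⊆ R ∨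
        BoxExcluded (Icc (x k) (x (k + 1)) ×ˢ Icc (y m) (y (m + 1)))) :
    IsingEnclosure (Icc (x 0) (x N) ×ˢ Icc (y 0) (y M)) R := by
  intro D hD hW
  have hmem := Icc_prod_subset_iUnion_cells x y hN hM hW
  simp only [mem_iUnion, Finset.mem_range, exists_prop] at hmem
  obtain ⟨k, hk, m, hm, hcellmem⟩ := hmem
  rcases hcell k hk m hm with hR | hX
  · exact hR hcellmem
  · exact (hX D hD hcellmem).elim

end Literature.MathematicalPhysics.QuantumFieldTheory.ConformalBootstrap3D
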